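import Summits.MatrixMultiplication.MatrixMultiplication.Theorems.SubgroupIdentityDesigns.Negative.SplitFunctional

/-!
# Dihedralised regular unipotent: a split exclusion with unipotent content (cell B2b-5, gen 21)

VALUE = THEOREM on the level-one slice of `SubgroupIdentityDesigns` — NOT summit progress; the crux
(`stmt-MatrixMultiplication-14079`) is untouched.

The GAP catalogue (ORACLE-g21 §G21-10b, kit j144577) lists at `(m,p) = (3,5)` a MINIMAL non-carrier
of order `20 = 4p` which is NOT a determinant cover: `K = (⟨J₃⟩ × ⟨-1⟩) ⋊ ⟨s⟩`, `J₃` the regular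
unipotent Jordan block and `s` an involution reversing it (`s J₃ s = J₃⁻¹`).  It is an instance of the
character-free CYCLIC-INDEX FUNCTIONAL (`SplitFunctional.no_design_of_split`, index `r = 2`): with
`U(t) = J₃^t = [[1,t,t(t-1)/2],[0,1,t],[0,0,1]]`, `s = [[1,0,0],[0,-1,1],[0,0,1]]` and
`N = {λ U(t) : t ∈ 𝔽_p, λ ∈ Λ}` for any `Λ ≤ 𝔽_pˣ` containing `-1`,
* `λ U(t) s ≠ 1` (its `(0,0)` entry is `λ`, its `(1,1)` entry is `-λ`; `p ≠ 2`);
* TRANSLATED ACTION: for every `v = (x,y,z)`: `s v = U(1 - 2y/z) v` if `z ≠ 0`,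
  `s v = -U(-2x/y) v` if `z = 0 ≠ y`, `s v = v` if `y = z = 0`;
so any cover of the `λ U(t) s^i ≠ 1` by `H₁ H₂ H₃` excludes a level-one identity design — for ALL odd
`p`, at `m = 3`, every `ε`.  Instances: the one-parameter group `U(𝔽_p)` in one member, the scalars
`Λ ∋ -1` in a member, `s` in a member (several placements below).  This is the first exclusion of the
programme whose unipotent content is a REGULAR unipotent (the transvection / root-group exclusions
concern rank-one unipotents).  Other frames follow by `DesignConjGL` (not restated here).  The
scalar `-1` is essential: `⟨J₃, s⟩ ≅ D_{2p}` alone IS a carrier (exact check `p = 3,5,7,11,13`,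
ORACLE-g21 §G21-20), so no cover hypothesis on it can be dropped.
-/

open scoped BigOperators Classical Matrix

set_option linter.dupNamespace false

namespace Summit.MatrixMultiplication.MatrixMultiplication.Theorems.SubgroupIdentityDesigns.Negative
namespace DihedralUnipotent

open Summit.MatrixMultiplication.MatrixMultiplication.Theorems.LieRankDesigns.Negative (GLm Mat)
open SplitFunctional (no_design_of_split)

variable {p : ℕ} [hp : Fact p.Prime]

/-- `2` is invertible in `𝔽_p` for `p ≠ 2`. -/
theorem two_mul_inv_two (hp2 : p ≠ 2) : (2 : ZMod p) * 2⁻¹ = 1 := by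
  apply mul_inv_cancel₀
  intro h
  have h' : ((2 : ℕ) : ZMod p) = 0 := by exact_mod_cast h
  rw [ZMod.natCast_eq_zero_iff] at h'
  exact hp2 ((Nat.prime_dvd_prime_iff_eq hp.out Nat.prime_two).mp h')

/-- `-1 ≠ 1` in `𝔽_p` for `p ≠ 2`. -/
theorem neg_one_ne_one (hp2 : p ≠ 2) : (-1 : ZMod p) ≠ 1 := by
  intro h
  have h2 : (2 : ZMod p) = 0 := by linear_combination -h
  have := two_mul_inv_two hp2
  rw [h2, zero_mul] at this
  exact zero_ne_one this

/-! ## The matrices -/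

/-- `U(t) = J₃^t`, the regular unipotent one-parameter group. -/
def Umat (t : ZMod p) : Mat p 3 := !![1, t, t * (t - 1) * 2⁻¹; 0, 1, t; 0, 0, 1]

/-- `U(0) = 1`. -/
theorem Umat_zero : Umat (0 : ZMod p) = 1 := by
  ext i j
  fin_cases i <;> fin_cases j <;> simp [Umat]

/-- `U(a) U(b) = U(a+b)` (`p` odd). -/
theorem Umat_mul (hp2 : p ≠ 2) (a b : ZMod p) : Umat a * Umat b = Umat (a + b) := by
  have h2 := two_mul_inv_two hp2
  ext i j
  fin_cases i <;> fin_cases j <;> simp [Umat, Matrix.mul_apply, Fin.sum_univ_three]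
  · ring
  · linear_combination (-(a * b)) * h2
  · ring

/-- `U` as a homomorphism `𝔽_p →* GL₃(𝔽_p)`. -/
def UGL (hp2 : p ≠ 2) : Multiplicative (ZMod p) →* GLm p 3 where
  toFun t := ⟨Umat t.toAdd, Umat (-t.toAdd),
    by rw [Umat_mul hp2, add_neg_cancel, Umat_zero],
    by rw [Umat_mul hp2, neg_add_cancel, Umat_zero]⟩
  map_one' := Units.ext (by simp [Umat_zero])
  map_mul' a b := Units.ext (by
    show Umat (a * b).toAdd = Umat a.toAdd * Umat b.toAdd
    rw [toAdd_mul, Umat_mul hp2])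

/-- The matrix of `U(t)`. -/
theorem coe_UGL (hp2 : p ≠ 2) (t : Multiplicative (ZMod p)) :
    ((UGL hp2 t : GLm p 3) : Mat p 3) = Umat t.toAdd := rfl

/-- Scalars `𝔽_pˣ →* GL₃(𝔽_p)`. -/
def scalarGL : (ZMod p)ˣ →* GLm p 3 :=
  Units.map ((algebraMap (ZMod p) (Mat p 3) : ZMod p →+* Mat p 3) : ZMod p →* Mat p 3)

/-- The matrix of a scalar. -/
theorem coe_scalarGL (c : (ZMod p)ˣ) :
    ((scalarGL c : GLm p 3) : Mat p 3) = algebraMap (ZMod p) (Mat p 3) (c : ZMod p) := rfl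

/-- Scalars commute with `U(t)`. -/
theorem commute_UGL_scalarGL (hp2 : p ≠ 2) (t : Multiplicative (ZMod p)) (c : (ZMod p)ˣ) :
    Commute (UGL hp2 t) (scalarGL c) := by
  rw [Commute, SemiconjBy]
  apply Units.ext
  simp only [Units.val_mul, coe_scalarGL]
  exact (Algebra.commutes (c : ZMod p) _).symm

/-- The reversing involution `s`. -/
def Smat : Mat p 3 := !![1, 0, 0; 0, -1, 1; 0, 0, 1]

/-- `s² = 1`. -/
theorem Smat_mul_Smat : (Smat : Mat p 3) * Smat = 1 := by
  ext i j
  fin_cases i <;> fin_cases j <;> simp [Smat, Matrix.mul_apply, Fin.sum_univ_three]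

/-- `s` as an element of `GL₃(𝔽_p)`. -/
def sGL : GLm p 3 := ⟨Smat, Smat, Smat_mul_Smat, Smat_mul_Smat⟩

/-- The matrix of `s`. -/
theorem coe_sGL : ((sGL : GLm p 3) : Mat p 3) = Smat := rfl

/-! ## The split pair `(N, s)` -/

/-- `N = {λ U(t)}`, `λ ∈ Λ`. -/
def N (hp2 : p ≠ 2) (Λ : Subgroup (ZMod p)ˣ) : Subgroup (GLm p 3) :=
  (MonoidHom.noncommCoprod (UGL hp2) (scalarGL.comp Λ.subtype)
    (fun t c => commute_UGL_scalarGL hp2 t c)).range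

/-- `λ U(t) ∈ N`. -/
theorem mem_N (hp2 : p ≠ 2) {Λ : Subgroup (ZMod p)ˣ} (t : ZMod p) {c : (ZMod p)ˣ} (hc : c ∈ Λ) :
    UGL hp2 (Multiplicative.ofAdd t) * scalarGL c ∈ N hp2 Λ :=
  ⟨(Multiplicative.ofAdd t, ⟨c, hc⟩), by simp [MonoidHom.noncommCoprod_apply]⟩

/-- `λ U(t) s` has `(0,0)` entry `λ`. -/
theorem entry₀₀ (t c : ZMod p) : (Umat t * (c • (1 : Mat p 3)) * Smat : Mat p 3) 0 0 = c := by
  simp [Umat, Smat, Matrix.mul_apply, Fin.sum_univ_three]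

/-- `λ U(t) s` has `(1,1)` entry `-λ`. -/
theorem entry₁₁ (t c : ZMod p) : (Umat t * (c • (1 : Mat p 3)) * Smat : Mat p 3) 1 1 = -c := by
  simp [Umat, Smat, Matrix.mul_apply, Fin.sum_univ_three]

/-- Hence `λ U(t) s ≠ 1` (`p ≠ 2`): the index-`2` non-degeneracy of the split pair. -/
theorem hone (hp2 : p ≠ 2) (Λ : Subgroup (ZMod p)ˣ) :
    ∀ n ∈ N hp2 Λ, ∀ i < 2, (n : GLm p 3) * sGL ^ i = 1 → i = 0 := by
  intro n hn i hi heq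
  by_contra hi0
  have hi1 : i = 1 := by omega
  subst hi1
  obtain ⟨⟨t, c⟩, rfl⟩ := hn
  have hM := congrArg (fun g : GLm p 3 => (g : Mat p 3)) heq
  simp only [pow_one, Units.val_mul, MonoidHom.noncommCoprod_apply, MonoidHom.coe_comp,
    Function.comp_apply, Subgroup.coe_subtype, coe_UGL, coe_scalarGL, coe_sGL, Units.val_one,
    Algebra.algebraMap_eq_smul_one] at hM
  have h00 := congrFun (congrFun hM 0) 0
  have h11 := congrFun (congrFun hM 1) 1
  rw [entry₀₀, Matrix.one_apply_eq] at h00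
  rw [entry₁₁, Matrix.one_apply_eq] at h11
  apply neg_one_ne_one hp2
  linear_combination h11 + h00

/-- `(λ U(t)) v` in coordinates. -/
theorem smulU_mulVec (t c : ZMod p) (v : Fin 3 → ZMod p) :
    (Umat t * (c • (1 : Mat p 3))) *ᵥ v =
      ![c * (v 0 + t * v 1 + t * (t - 1) * 2⁻¹ * v 2), c * (v 1 + t * v 2), c * v 2] := by
  rw [Matrix.mul_smul, Matrix.mul_one, Matrix.smul_mulVec]
  ext j
  fin_cases j <;> simp [Umat, dotProduct, Fin.sum_univ_three]

/-- `s v` in coordinates. -/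
theorem S_mulVec (v : Fin 3 → ZMod p) : (Smat : Mat p 3) *ᵥ v = ![v 0, -v 1 + v 2, v 2] := by
  ext j
  fin_cases j <;> simp [Smat, Matrix.mulVec, dotProduct, Fin.sum_univ_three]

/-- TRANSLATED ACTION: `s v ∈ N v` for every `v` (needs `-1 ∈ Λ`):
`s v = U(1 - 2y/z) v` (`z ≠ 0`), `s v = -U(-2x/y) v` (`z = 0 ≠ y`), `s v = v` (`y = z = 0`). -/
theorem htr (hp2 : p ≠ 2) {Λ : Subgroup (ZMod p)ˣ} (hΛ : (-1 : (ZMod p)ˣ) ∈ Λ) :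
    ∀ i < 2, ∀ v : Fin 3 → ZMod p, ∃ n ∈ N hp2 Λ,
      ((sGL ^ i : GLm p 3) : Mat p 3) *ᵥ v = ((n : GLm p 3) : Mat p 3) *ᵥ v := by
  have h2 := two_mul_inv_two hp2
  intro i hi v
  by_cases hi1 : i = 1
  swap
  · refine ⟨1, Subgroup.one_mem _, ?_⟩
    have : i = 0 := by omega
    subst this
    simp
  subst hi1
  rw [pow_one, coe_sGL, S_mulVec]
  by_cases hz : v 2 = 0
  · by_cases hy : v 1 = 0
    · -- `v = (x,0,0)` is fixed by `s`
      refine ⟨1, Subgroup.one_mem _, ?_⟩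
      rw [Units.val_one, Matrix.one_mulVec]
      ext j; fin_cases j <;> simp [hz, hy]
    · -- `s v = -U(-2x/y) v`
      have hy' : v 1 * (v 1)⁻¹ = 1 := mul_inv_cancel₀ hy
      refine ⟨_, mem_N hp2 (-2 * v 0 * (v 1)⁻¹) hΛ, ?_⟩
      rw [Units.val_mul, coe_UGL, coe_scalarGL, toAdd_ofAdd, Algebra.algebraMap_eq_smul_one,
        Units.val_neg, Units.val_one, smulU_mulVec, hz]
      refine Matrix.vecCons_inj.mpr ⟨?_, Matrix.vecCons_inj.mpr ⟨?_, Matrix.vecCons_inj.mpr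
        ⟨?_, Subsingleton.elim _ _⟩⟩⟩
      · linear_combination (-2 * v 0) * hy'
      · ring
      · ring
  · -- `s v = U(1 - 2y/z) v`
    have hz' : v 2 * (v 2)⁻¹ = 1 := mul_inv_cancel₀ hz
    refine ⟨_, mem_N hp2 (1 - 2 * v 1 * (v 2)⁻¹) Λ.one_mem, ?_⟩
    rw [Units.val_mul, coe_UGL, coe_scalarGL, toAdd_ofAdd, Algebra.algebraMap_eq_smul_one,
      Units.val_one, smulU_mulVec]
    refine Matrix.vecCons_inj.mpr ⟨?_, Matrix.vecCons_inj.mpr ⟨?_, Matrix.vecCons_inj.mpr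
      ⟨?_, Subsingleton.elim _ _⟩⟩⟩
    · linear_combination ((1 - 2 * v 1 * (v 2)⁻¹) * v 1) * h2 +
        (2 * 2⁻¹ * (1 - 2 * v 1 * (v 2)⁻¹) * v 1) * hz'
    · linear_combination (2 * v 1) * hz'
    · ring

/-! ## Conjugation by `s` and centrality of the scalars -/

/-- `s U(a) s = U(-a)`: `s` reverses the one-parameter group. -/
theorem Smat_Umat_Smat (hp2 : p ≠ 2) (a : ZMod p) : (Smat : Mat p 3) * Umat a * Smat = Umat (-a) := by
  have h2 := two_mul_inv_two hp2
  ext i j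
  fin_cases i <;> fin_cases j <;> simp [Umat, Smat, Matrix.mul_apply, Fin.sum_univ_three]
  linear_combination (-a) * h2

/-- `s⁻¹ = s`. -/
theorem sGL_inv : (sGL : GLm p 3)⁻¹ = sGL :=
  inv_eq_of_mul_eq_one_right (Units.ext Smat_mul_Smat)

/-- `s⁻¹ U(t) s = U(t⁻¹)` in `GL₃(𝔽_p)`. -/
theorem sGL_conj_UGL (hp2 : p ≠ 2) (t : Multiplicative (ZMod p)) :
    (sGL : GLm p 3)⁻¹ * UGL hp2 t * sGL = UGL hp2 t⁻¹ := by
  rw [sGL_inv]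
  apply Units.ext
  simp only [Units.val_mul, coe_sGL, coe_UGL, toAdd_inv]
  exact Smat_Umat_Smat hp2 _

/-- The range of `U` is stable under conjugation by `s`. -/
theorem conj_mem_range (hp2 : p ≠ 2) :
    ∀ x ∈ (UGL hp2).range, (sGL : GLm p 3)⁻¹ * x * sGL ∈ (UGL hp2).range := by
  rintro x ⟨t, rfl⟩
  exact ⟨t⁻¹, (sGL_conj_UGL hp2 t).symm⟩

/-- Scalars are central. -/
theorem scalarGL_comm (c : (ZMod p)ˣ) (g : GLm p 3) : g * scalarGL c = scalarGL c * g := by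
  apply Units.ext
  simp only [Units.val_mul, coe_scalarGL]
  exact (Algebra.commutes (c : ZMod p) _).symm

/-! ## The exclusions (`m = 3`, all odd `p`, every `ε`) -/

variable {H₁ H₂ H₃ : Subgroup (GLm p 3)}

/-- Shared core: any cover of the `λ U(t) s^i ≠ 1` (`λ ∈ Λ ∋ -1`) by `H₁ H₂ H₃` excludes a
level-one identity design. -/
theorem no_design_of_cover (hp2 : p ≠ 2) {Λ : Subgroup (ZMod p)ˣ} (hΛ : (-1 : (ZMod p)ˣ) ∈ Λ)
    (hcov : ∀ n ∈ N hp2 Λ, ∀ i < 2, (n : GLm p 3) * sGL ^ i ≠ 1 →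
      ∃ a ∈ H₁, ∃ b ∈ H₂, ∃ c ∈ H₃, a * b * c = n * sGL ^ i) :
    ¬ ∃ c : Mat p 3 → ℂ, (∀ M, 1 < M.rank → c M = 0) ∧
      (∑ M, c M * ZMod.stdAddChar (Matrix.trace (M * ((1 : GLm p 3) : Mat p 3)))) = 1 ∧
      ∀ a ∈ H₁, ∀ b ∈ H₂, ∀ g ∈ H₃, a * b * g ≠ 1 →
        (∑ M, c M * ZMod.stdAddChar (Matrix.trace (M * ((a * b * g : GLm p 3) : Mat p 3)))) = 0 :=
  no_design_of_split (N hp2 Λ) sGL (le_refl 2) (hone hp2 Λ) (htr hp2 hΛ) hcov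

/-- **ONE GENERATOR PER MEMBER `(U, Λ, s) ↦ (H₁, H₂, H₃)`**: the regular unipotent group `U(𝔽_p)`
in `H₁`, scalars `Λ ∋ -1` in `H₂`, the reversing involution `s` in `H₃` ⇒ no level-one design. -/
theorem no_design_UΛs (hp2 : p ≠ 2) {Λ : Subgroup (ZMod p)ˣ} (hΛ : (-1 : (ZMod p)ˣ) ∈ Λ)
    (hU : ∀ t, UGL hp2 t ∈ H₁) (hΛ₂ : ∀ c ∈ Λ, scalarGL c ∈ H₂) (hs : sGL ∈ H₃) :
    ¬ ∃ c : Mat p 3 → ℂ, (∀ M, 1 < M.rank → c M = 0) ∧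
      (∑ M, c M * ZMod.stdAddChar (Matrix.trace (M * ((1 : GLm p 3) : Mat p 3)))) = 1 ∧
      ∀ a ∈ H₁, ∀ b ∈ H₂, ∀ g ∈ H₃, a * b * g ≠ 1 →
        (∑ M, c M * ZMod.stdAddChar (Matrix.trace (M * ((a * b * g : GLm p 3) : Mat p 3)))) = 0 := by
  refine no_design_of_cover hp2 hΛ fun n hn i _ _ => ?_
  obtain ⟨⟨t, c⟩, rfl⟩ := hn
  exact ⟨UGL hp2 t, hU t, scalarGL c, hΛ₂ c c.2, sGL ^ i, H₃.pow_mem hs i,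
    by simp [MonoidHom.noncommCoprod_apply]⟩

/-- **`(U, Λ, s) ↦ (H₁, H₃, H₂)`**. -/
theorem no_design_UsΛ (hp2 : p ≠ 2) {Λ : Subgroup (ZMod p)ˣ} (hΛ : (-1 : (ZMod p)ˣ) ∈ Λ)
    (hU : ∀ t, UGL hp2 t ∈ H₁) (hs : sGL ∈ H₂) (hΛ₃ : ∀ c ∈ Λ, scalarGL c ∈ H₃) :
    ¬ ∃ c : Mat p 3 → ℂ, (∀ M, 1 < M.rank → c M = 0) ∧
      (∑ M, c M * ZMod.stdAddChar (Matrix.trace (M * ((1 : GLm p 3) : Mat p 3)))) = 1 ∧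
      ∀ a ∈ H₁, ∀ b ∈ H₂, ∀ g ∈ H₃, a * b * g ≠ 1 →
        (∑ M, c M * ZMod.stdAddChar (Matrix.trace (M * ((a * b * g : GLm p 3) : Mat p 3)))) = 0 := by
  refine no_design_of_cover hp2 hΛ fun n hn i _ _ => ?_
  obtain ⟨⟨t, c⟩, rfl⟩ := hn
  refine ⟨UGL hp2 t, hU t, sGL ^ i, H₂.pow_mem hs i, scalarGL c, hΛ₃ c c.2, ?_⟩
  simp only [MonoidHom.noncommCoprod_apply, MonoidHom.coe_comp, Function.comp_apply,
    Subgroup.coe_subtype]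
  rw [mul_assoc, scalarGL_comm, ← mul_assoc, mul_assoc (UGL hp2 t)]

/-- **`(U, Λ, s) ↦ (H₂, H₁, H₃)`**. -/
theorem no_design_ΛUs (hp2 : p ≠ 2) {Λ : Subgroup (ZMod p)ˣ} (hΛ : (-1 : (ZMod p)ˣ) ∈ Λ)
    (hΛ₁ : ∀ c ∈ Λ, scalarGL c ∈ H₁) (hU : ∀ t, UGL hp2 t ∈ H₂) (hs : sGL ∈ H₃) :
    ¬ ∃ c : Mat p 3 → ℂ, (∀ M, 1 < M.rank → c M = 0) ∧
      (∑ M, c M * ZMod.stdAddChar (Matrix.trace (M * ((1 : GLm p 3) : Mat p 3)))) = 1 ∧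
      ∀ a ∈ H₁, ∀ b ∈ H₂, ∀ g ∈ H₃, a * b * g ≠ 1 →
        (∑ M, c M * ZMod.stdAddChar (Matrix.trace (M * ((a * b * g : GLm p 3) : Mat p 3)))) = 0 := by
  refine no_design_of_cover hp2 hΛ fun n hn i _ _ => ?_
  obtain ⟨⟨t, c⟩, rfl⟩ := hn
  refine ⟨scalarGL c, hΛ₁ c c.2, UGL hp2 t, hU t, sGL ^ i, H₃.pow_mem hs i, ?_⟩
  simp only [MonoidHom.noncommCoprod_apply, MonoidHom.coe_comp, Function.comp_apply,
    Subgroup.coe_subtype]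
  rw [← scalarGL_comm]

/-- **`(U, Λ, s) ↦ (H₃, H₁, H₂)`** (reorder with `s^{-i} U(t) s^i = U(±t)`). -/
theorem no_design_ΛsU (hp2 : p ≠ 2) {Λ : Subgroup (ZMod p)ˣ} (hΛ : (-1 : (ZMod p)ˣ) ∈ Λ)
    (hΛ₁ : ∀ c ∈ Λ, scalarGL c ∈ H₁) (hs : sGL ∈ H₂) (hU : ∀ t, UGL hp2 t ∈ H₃) :
    ¬ ∃ c : Mat p 3 → ℂ, (∀ M, 1 < M.rank → c M = 0) ∧
      (∑ M, c M * ZMod.stdAddChar (Matrix.trace (M * ((1 : GLm p 3) : Mat p 3)))) = 1 ∧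
      ∀ a ∈ H₁, ∀ b ∈ H₂, ∀ g ∈ H₃, a * b * g ≠ 1 →
        (∑ M, c M * ZMod.stdAddChar (Matrix.trace (M * ((a * b * g : GLm p 3) : Mat p 3)))) = 0 := by
  have hle : (UGL hp2).range ≤ H₃ := fun x ⟨t, ht⟩ => ht ▸ hU t
  refine no_design_of_cover hp2 hΛ fun n hn i _ _ => ?_
  obtain ⟨⟨t, c⟩, rfl⟩ := hn
  refine ⟨scalarGL c, hΛ₁ c c.2, sGL ^ i, H₂.pow_mem hs i, (sGL ^ i)⁻¹ * UGL hp2 t * sGL ^ i,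
    hle (SplitFunctional.conj_pow_mem (conj_mem_range hp2) ⟨t, rfl⟩ i), ?_⟩
  simp only [MonoidHom.noncommCoprod_apply, MonoidHom.coe_comp, Function.comp_apply,
    Subgroup.coe_subtype]
  rw [scalarGL_comm (c : (ZMod p)ˣ) (UGL hp2 t)]
  group

/-- **`(U, Λ, s) ↦ (H₂, H₃, H₁)`**. -/
theorem no_design_sUΛ (hp2 : p ≠ 2) {Λ : Subgroup (ZMod p)ˣ} (hΛ : (-1 : (ZMod p)ˣ) ∈ Λ)
    (hs : sGL ∈ H₁) (hU : ∀ t, UGL hp2 t ∈ H₂) (hΛ₃ : ∀ c ∈ Λ, scalarGL c ∈ H₃) :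
    ¬ ∃ c : Mat p 3 → ℂ, (∀ M, 1 < M.rank → c M = 0) ∧
      (∑ M, c M * ZMod.stdAddChar (Matrix.trace (M * ((1 : GLm p 3) : Mat p 3)))) = 1 ∧
      ∀ a ∈ H₁, ∀ b ∈ H₂, ∀ g ∈ H₃, a * b * g ≠ 1 →
        (∑ M, c M * ZMod.stdAddChar (Matrix.trace (M * ((a * b * g : GLm p 3) : Mat p 3)))) = 0 := by
  have hle : (UGL hp2).range ≤ H₂ := fun x ⟨t, ht⟩ => ht ▸ hU t
  refine no_design_of_cover hp2 hΛ fun n hn i _ _ => ?_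
  obtain ⟨⟨t, c⟩, rfl⟩ := hn
  refine ⟨sGL ^ i, H₁.pow_mem hs i, (sGL ^ i)⁻¹ * UGL hp2 t * sGL ^ i,
    hle (SplitFunctional.conj_pow_mem (conj_mem_range hp2) ⟨t, rfl⟩ i), scalarGL c, hΛ₃ c c.2, ?_⟩
  simp only [MonoidHom.noncommCoprod_apply, MonoidHom.coe_comp, Function.comp_apply,
    Subgroup.coe_subtype]
  rw [mul_assoc (UGL hp2 t), ← scalarGL_comm (c : (ZMod p)ˣ) (sGL ^ i)]
  group

/-- **`(U, Λ, s) ↦ (H₃, H₂, H₁)`**. -/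
theorem no_design_sΛU (hp2 : p ≠ 2) {Λ : Subgroup (ZMod p)ˣ} (hΛ : (-1 : (ZMod p)ˣ) ∈ Λ)
    (hs : sGL ∈ H₁) (hΛ₂ : ∀ c ∈ Λ, scalarGL c ∈ H₂) (hU : ∀ t, UGL hp2 t ∈ H₃) :
    ¬ ∃ c : Mat p 3 → ℂ, (∀ M, 1 < M.rank → c M = 0) ∧
      (∑ M, c M * ZMod.stdAddChar (Matrix.trace (M * ((1 : GLm p 3) : Mat p 3)))) = 1 ∧
      ∀ a ∈ H₁, ∀ b ∈ H₂, ∀ g ∈ H₃, a * b * g ≠ 1 →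
        (∑ M, c M * ZMod.stdAddChar (Matrix.trace (M * ((a * b * g : GLm p 3) : Mat p 3)))) = 0 := by
  have hle : (UGL hp2).range ≤ H₃ := fun x ⟨t, ht⟩ => ht ▸ hU t
  refine no_design_of_cover hp2 hΛ fun n hn i _ _ => ?_
  obtain ⟨⟨t, c⟩, rfl⟩ := hn
  refine ⟨sGL ^ i, H₁.pow_mem hs i, scalarGL c, hΛ₂ c c.2, (sGL ^ i)⁻¹ * UGL hp2 t * sGL ^ i,
    hle (SplitFunctional.conj_pow_mem (conj_mem_range hp2) ⟨t, rfl⟩ i), ?_⟩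
  simp only [MonoidHom.noncommCoprod_apply, MonoidHom.coe_comp, Function.comp_apply,
    Subgroup.coe_subtype]
  rw [scalarGL_comm (c : (ZMod p)ˣ) (sGL ^ i), scalarGL_comm (c : (ZMod p)ˣ) (UGL hp2 t)]
  group

/-- **SAME MEMBER**: `U(𝔽_p)`, `Λ` and `s` all in `H₁` ⇒ no level-one design (the whole
non-carrier `K = (U × Λ) ⋊ ⟨s⟩` inside one member; character-free form of "K is a linearly
detected non-carrier"). -/
theorem no_design_same₁ (hp2 : p ≠ 2) {Λ : Subgroup (ZMod p)ˣ} (hΛ : (-1 : (ZMod p)ˣ) ∈ Λ)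
    (hU : ∀ t, UGL hp2 t ∈ H₁) (hΛ₁ : ∀ c ∈ Λ, scalarGL c ∈ H₁) (hs : sGL ∈ H₁) :
    ¬ ∃ c : Mat p 3 → ℂ, (∀ M, 1 < M.rank → c M = 0) ∧
      (∑ M, c M * ZMod.stdAddChar (Matrix.trace (M * ((1 : GLm p 3) : Mat p 3)))) = 1 ∧
      ∀ a ∈ H₁, ∀ b ∈ H₂, ∀ g ∈ H₃, a * b * g ≠ 1 →
        (∑ M, c M * ZMod.stdAddChar (Matrix.trace (M * ((a * b * g : GLm p 3) : Mat p 3)))) = 0 := by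
  refine no_design_of_cover hp2 hΛ fun n hn i _ _ => ?_
  obtain ⟨⟨t, c⟩, rfl⟩ := hn
  refine ⟨_, H₁.mul_mem (H₁.mul_mem (hU t) (hΛ₁ c c.2)) (H₁.pow_mem hs i), 1, H₂.one_mem, 1,
    H₃.one_mem, ?_⟩
  simp [MonoidHom.noncommCoprod_apply]

end DihedralUnipotent
end Summit.MatrixMultiplication.MatrixMultiplication.Theorems.SubgroupIdentityDesigns.Negative
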